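import Summits.ValiantsHypothesis.ValiantsHypothesis.Theorems.LacunarySymmetroidMatrixDescartesDoorA26WallBubblingTwoScaleTripleMid

/-!
# Wall bubbling for `DoorA26` — THE PURE-CLASS MID RULE OVER ABSTRACT FRAMES (for the three-pair chain)

HONEST FRAMING.  Obligation (W) `stub_weylFaces` of `Cruxes/DoorA26/Lines/wall_bubbling.lean` (crux `DoorA26`, stmt-ValiantsHypothesis-19979; OPEN,
typed, never asserted); W1 seat val-sym-door-p2 g14.  W2's rung `twoScale_triple_mid` (door-p1 g14, `…TwoScaleTripleMid`) is stated on the ONE-PAIR frame (if-chains with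
special positions `0,5`); W1 g13 re-framed it for two pairs at `(0,5)` and `(1,4)` (#48–#50b).  The three-pair chain (`ValueGenericThreePairChain26`,
OPEN) needs it for the three pure classes `2δ₀, 2δ₁, 2δ₂` of the THREE-PAIR frame.  Since W2's scalar core reads only the entries at positions
`0, 5`, the rule holds for ANY frames prescribed at those two positions — whatever they are elsewhere:

* **`pure_mid_frames`** — frame equations `hF0, hF5` (and primed / indexed ones at the later scales), dominations / Gram-normalised limits for
  `polar (F ν a) (F ν b)`; conclusion `Γ 0 5 ≠ 0 → Γ' 5 5 = 0`.

Three-pair (and two-pair) instances: relabel the letters (`U ∘ σ`, `δs ∘ σ`) so the pair sits at `(0,5)` and discharge the frame equations by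
`simp` (port memo `HOME/val-sym-door-p2/g14/THREE-PAIR-CHAIN-PORT.md`).  Proof = W2's verbatim with the if-chain evaluations replaced by the frame
equations.  Registers unchanged; (W), `ValueGenericThreePairChain26`, `DoorA26` 19979, 18050 OPEN; nothing on VP ≠ VNP.  Def-free.
`--supports stmt-ValiantsHypothesis-19979 --as helper`.
-/

-- `Summit.ValiantsHypothesis.ValiantsHypothesis.…` repeats a component by the D-0017 layout
-- (single-conjunct summit), which the `dupNamespace` linter flags; the name is mandated.
set_option linter.dupNamespace false

namespace Summit.ValiantsHypothesis.ValiantsHypothesis.Theorems.LacunarySymmetroidMatrixDescartes.WallBubbling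

open Finset Filter Topology
open Bubbling (polar)
open scoped BigOperators

/-- **PURE-CLASS MID RULE OVER ABSTRACT FRAMES** (see the module docstring). [W2's rung 4, re-framed] -/
theorem pure_mid_frames (δs : ℕ → Fin 6 → ℝ) (δ0 : Fin 6 → ℝ)
    (hδ : ∀ l, Tendsto (fun ν => δs ν l) atTop (𝓝 (δ0 l))) (h05 : δ0 5 = δ0 0)
    (U : ℕ → Fin 6 → Matrix (Fin 2) (Fin 2) ℝ) (F F' : ℕ → Fin 6 → Matrix (Fin 2) (Fin 2) ℝ) (L : ℕ → ℝ) (hL : Tendsto L atTop atTop)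
    (hF0 : ∀ ν, F ν 0 = U ν 0 + U ν 5) (hF5 : ∀ ν, F ν 5 = (δs ν 5 - δs ν 0) • U ν 5)
    (hF'0 : ∀ ν, F' ν 0 = Real.exp (δs ν 0 * L ν) • U ν 0 + Real.exp (δs ν 5 * L ν) • U ν 5)
    (hF'5 : ∀ ν, F' ν 5 = (δs ν 5 - δs ν 0) • (Real.exp (δs ν 5 * L ν) • U ν 5))
    (μ μ' : ℕ → ℝ) (hμ : ∀ ν, 0 < μ ν) (hμ' : ∀ ν, 0 < μ' ν)
    (hdom : ∀ ν a b, |polar (F ν a) (F ν b)| ≤ μ ν) (hdom' : ∀ ν a b, |polar (F' ν a) (F' ν b)| ≤ μ' ν)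
    (Γ Γ' : Fin 6 → Fin 6 → ℝ)
    (hΓ : ∀ a b, Tendsto (fun ν => polar (F ν a) (F ν b) / μ ν) atTop (𝓝 (Γ a b)))
    (hΓ' : ∀ a b, Tendsto (fun ν => polar (F' ν a) (F' ν b) / μ' ν) atTop (𝓝 (Γ' a b)))
    (h1 : Γ 0 5 ≠ 0) : Γ' 5 5 = 0 := by
  by_contra h2
  set κ : ℝ := |Γ 0 5| / 2 with hκ
  set κ' : ℝ := |Γ' 5 5| / 2 with hκ'
  have hκpos : 0 < κ := by rw [hκ]; exact half_pos (abs_pos.mpr h1)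
  have hκ'pos : 0 < κ' := by rw [hκ']; exact half_pos (abs_pos.mpr h2)
  have hw0 : Tendsto (fun ν => δs ν 5 - δs ν 0) atTop (𝓝 0) := by
    have := (hδ 5).sub (hδ 0)
    rw [h05, sub_self] at this
    exact this
  have e1 : ∀ᶠ ν in atTop, κ * μ ν ≤ |polar (U ν 0 + U ν 5) ((δs ν 5 - δs ν 0) • U ν 5)| := by
    have h := ((hΓ 0 5).abs).eventually_const_lt (show κ < |Γ 0 5| by rw [hκ]; linarith [abs_pos.mpr h1])
    filter_upwards [h] with ν hν
    simp only [hF0 ν, hF5 ν] at hν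
    rw [abs_div, abs_of_pos (hμ ν), lt_div_iff₀ (hμ ν)] at hν
    exact hν.le
  have e2 : ∀ᶠ ν in atTop, κ' * μ' ν
      ≤ |polar ((δs ν 5 - δs ν 0) • (Real.exp (δs ν 5 * L ν) • U ν 5)) ((δs ν 5 - δs ν 0) • (Real.exp (δs ν 5 * L ν) • U ν 5))| := by
    have h := ((hΓ' 5 5).abs).eventually_const_lt (show κ' < |Γ' 5 5| by rw [hκ']; linarith [abs_pos.mpr h2])
    filter_upwards [h] with ν hν
    simp only [hF'5 ν] at hν
    rw [abs_div, abs_of_pos (hμ' ν), lt_div_iff₀ (hμ' ν)] at hν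
    exact hν.le
  have eb : ∀ᶠ ν in atTop, 0 * Real.exp ((δs ν 5 - δs ν 0) * L ν) + 4 / κ
      < |dslope (fun y : ℝ => Real.exp (y * L ν)) 0 (δs ν 5 - δs ν 0)| :=
    eventually_dslope_exp_gt (fun ν => δs ν 5 - δs ν 0) L hw0 hL 0 (4 / κ) le_rfl (by positivity)
  have ea : ∀ᶠ ν in atTop, (1 + 12 / κ') * Real.exp ((δs ν 5 - δs ν 0) * L ν) + 0
      < |dslope (fun y : ℝ => Real.exp (y * L ν)) 0 (δs ν 5 - δs ν 0)| :=
    eventually_dslope_exp_gt (fun ν => δs ν 5 - δs ν 0) L hw0 hL (1 + 12 / κ') 0 (by positivity) le_rfl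
  have hfalse : ∀ᶠ ν : ℕ in atTop, False := by
    filter_upwards [e1, e2, eb, ea] with ν hν1 hν2 hνb hνa
    obtain ⟨i55, i05, i00⟩ := triple_frameShift (δs ν) (U ν) (L ν)
    set g55 := polar ((δs ν 5 - δs ν 0) • U ν 5) ((δs ν 5 - δs ν 0) • U ν 5) with hg55
    set g05 := polar (U ν 0 + U ν 5) ((δs ν 5 - δs ν 0) • U ν 5) with hg05
    set g00 := polar (U ν 0 + U ν 5) (U ν 0 + U ν 5) with hg00
    set Λ := dslope (fun y : ℝ => Real.exp (y * L ν)) 0 (δs ν 5 - δs ν 0) with hΛ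
    set E₀ := Real.exp (δs ν 0 * L ν) with hE₀
    set e := Real.exp ((δs ν 5 - δs ν 0) * L ν) with he
    have hE₀pos : 0 < E₀ := Real.exp_pos _
    have hepos : 0 < e := Real.exp_pos _
    have h00le : |g00| ≤ μ ν := by have := hdom ν 0 0; simp only [hF0 ν] at this; exact this
    have hdom00 : E₀ * E₀ * |g00 + 2 * Λ * g05 + Λ * Λ * g55| ≤ μ' ν := by
      have := hdom' ν 0 0
      simp only [hF'0 ν] at this
      rw [i00, abs_mul, abs_of_pos (mul_pos hE₀pos hE₀pos)] at this
      exact this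
    have hdom05 : E₀ * E₀ * e * |g05 + Λ * g55| ≤ μ' ν := by
      have := hdom' ν 0 5
      simp only [hF'0 ν, hF'5 ν] at this
      rw [i05, abs_mul, abs_of_pos (by positivity)] at this
      exact this
    have halive : κ' * μ' ν ≤ E₀ * E₀ * (e * e) * |g55| := by
      rw [i55, abs_mul, abs_of_pos (by positivity)] at hν2
      exact hν2
    have hΛge : 4 / κ ≤ |Λ| := by rw [zero_mul, zero_add] at hνb; exact hνb.le
    have hcore := triple_mid_core hκpos hκ'pos (hμ ν) hepos hE₀pos hν1 h00le hdom00 hdom05 halive hΛge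
    rw [add_zero] at hνa
    exact absurd (lt_of_le_of_lt hcore hνa) (lt_irrefl _)
  exact hfalse.exists.elim fun _ h => h


end Summit.ValiantsHypothesis.ValiantsHypothesis.Theorems.LacunarySymmetroidMatrixDescartes.WallBubbling
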